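import Literature.AlgebraicGeometry.Motives.GrassmannianFunctorZariskiSheaf
import Mathlib.AlgebraicGeometry.AffineScheme
import HarnessLib

/-!
# The Grassmannian as a Zariski sheaf on the category of schemes

Topic `AlgebraicGeometry/Motives`; namespace `Literature.AlgebraicGeometry.Motives.Grassmannian`.
DEFINITIONS (the sheaf, its comparison with the ring-side functor on affine schemes, evaluation on affine opens) + their
naturality lemmas.  No instance, no notation, no named fact, no `sorry`.

[GortzWedhorn2020, (8.4) pp. 213–215 with Ch. 8 Exercise 8.1]: a functor on rings which is a Zariski sheaf on affine schemes
extends uniquely to a Zariski sheaf on all schemes.  ★ `isSheaf_grassmannianFunctor` ((D2)) says that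
★ `grassmannianFunctor M k : CommRingCat ⥤ Type` (`A ↦ G(k, A ⊗_ℤ M; A)`, Mathlib `Module.Grassmannian`) is a sheaf for the
topology `J₀` induced on `CommRingCatᵒᵖ` by the big Zariski topology; ★ `isEquivalence_sheafPushforwardContinuous_Spec`
(B-p09, the comparison lemma «Zariski sheaves on schemes = Zariski sheaves on affine schemes», no universe bump) then
produces:

* `grassmannianAffineSheaf M k : Sheaf J₀ (Type u)` — the ring-side functor as a sheaf on affine schemes;
* **`grassmannianSheaf M k : Sheaf Scheme.zariskiTopology.{u} (Type u)`** — THE GRASSMANNIAN OF `M` AS A ZARISKI SHEAF ON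
  `Scheme.{u}` (the inverse of the comparison equivalence applied to `grassmannianAffineSheaf`);
* `grassmannianSheafSpecIso M k : Scheme.Spec.op ⋙ (grassmannianSheaf M k).obj ≅ unopUnop _ ⋙ grassmannianFunctor M k` —
  its values on affine schemes ARE the Grassmannian functor, naturally (counit of the equivalence);
  `specEquiv M k A : Gr(Spec A) ≃ G(k, A ⊗_ℤ M; A)` pointwise, with `specEquiv_naturality`;
* `evalAffine M k hU : Gr(X) → G(k, Γ(X, U) ⊗_ℤ M; Γ(X, U))` for an affine open `U ⊆ X` (restrict along
  `hU.fromSpec : Spec Γ(X, U) ⟶ X`, then `specEquiv`), with `evalAffine_map` (naturality along `f : X ⟶ Y` and affine opens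
  `V ⊆ f⁻¹U`, ring map `f.appLE U V`), `evalAffine_of_le` (restriction to a smaller affine open) and `evalAffine_top`
  (on an affine scheme, `evalAffine ⊤` is `specEquiv` up to `Γ(Spec A, ⊤) ≅ A`, hence bijective: `bijective_evalAffine_top`);
* §4, under `[(grassmannianSheaf M k).obj.IsRepresentable]` (the representability theorem (A4), separate file):
  **`grassmannianScheme M k : Scheme.{u}`** (`reprX`), `pointsEquiv T : (T ⟶ grassmannianScheme M k) ≃ Gr(T)` (+ `pointsEquiv_comp`),
  **`specPointsEquiv A : (Spec A ⟶ grassmannianScheme M k) ≃ Module.Grassmannian A (A ⊗[ℤ] M) k`** (+ `specPointsEquiv_naturality`) —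
  the scheme represents Mathlib's Grassmannian functor on affine schemes.

This is the AFFINE-EVALUATION INTERFACE through which the chart subfunctors / open conditions of (h4) (A3) and the
representability assembly (A4) (★ `isRepresentable_of_openCondition_cover`) access `grassmannianSheaf`; no formula for
`Gr(X)` on a non-affine `X` is ever needed (sections are determined on affine opens by the sheaf property).
Cell `hodgecm-mathlib` (D-0151), F-DAG first hand (h4) «Grassmannian as a scheme» (B-p21 (g15) author; B-p18 (g17) charts,
B-p09 (g12) sites), count-neutral Mathlib-side capital (brick (D3)).  Nothing here is about HC; HC_CM is proved only modulo
the 7 printed citations until rung 0 closes.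

## References
* [GortzWedhorn2020] U. Görtz, T. Wedhorn, *Algebraic Geometry I*, 2nd ed. (2020), (8.4) (pp. 213–215), Ch. 8 Exercise 8.1.
* [StacksProject] The Stacks project, Tag 089R (Grassmannians), Tag 020W (Zariski sheaves and affine schemes).
-/

namespace Literature.AlgebraicGeometry.Motives.Grassmannian

open CategoryTheory Opposite TensorProduct _root_.AlgebraicGeometry

universe u

variable (M : Type u) [AddCommGroup M] (k : ℕ)

/-! ## §1 The sheaf -/

/-- The Grassmannian functor `A ↦ G(k, A ⊗_ℤ M; A)` as a `Type u`-valued sheaf on affine schemes `CommRingCatᵒᵖ` for the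
topology induced by the big Zariski topology (★ `isSheaf_grassmannianFunctor`). [cite: GortzWedhorn2020, (8.4) (pp. 213–215)] -/
noncomputable def grassmannianAffineSheaf :
    Sheaf (Scheme.Spec.inducedTopology Scheme.zariskiTopology.{u}) (Type u) :=
  ⟨unopUnop CommRingCat.{u} ⋙ grassmannianFunctor.{u, u} M k, isSheaf_grassmannianFunctor M k⟩

/-- **The Grassmannian of the abelian group `M` (quotients locally free of rank `k`) as a Zariski sheaf on `Scheme.{u}`**:
the unique extension of the Zariski sheaf `grassmannianAffineSheaf M k` on affine schemes along the comparison equivalence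
★ `isEquivalence_sheafPushforwardContinuous_Spec` («Zariski sheaves on schemes = Zariski sheaves on affine schemes»).
For `M = ℤⁿ` this is the functor of points of the Grassmannian `Gr(n, k)`.
[cite: GortzWedhorn2020, (8.4) (pp. 213–215)] [cite: StacksProject, Tag 089R] -/
noncomputable def grassmannianSheaf : Sheaf Scheme.zariskiTopology.{u} (Type u) :=
  haveI := isEquivalence_sheafPushforwardContinuous_Spec.{u}
  (Scheme.Spec.sheafPushforwardContinuous (Type u) (Scheme.Spec.inducedTopology Scheme.zariskiTopology.{u})
    Scheme.zariskiTopology.{u}).inv.obj (grassmannianAffineSheaf M k)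

/-- The restriction of `grassmannianSheaf M k` to affine schemes is (isomorphic to) `grassmannianAffineSheaf M k`: the counit
of the comparison equivalence. [cite: GortzWedhorn2020, Ch. 8 Exercise 8.1] -/
noncomputable def grassmannianSheafRestrictIso :
    (Scheme.Spec.sheafPushforwardContinuous (Type u) (Scheme.Spec.inducedTopology Scheme.zariskiTopology.{u})
      Scheme.zariskiTopology.{u}).obj (grassmannianSheaf M k) ≅ grassmannianAffineSheaf M k :=
  haveI := isEquivalence_sheafPushforwardContinuous_Spec.{u}
  (Scheme.Spec.sheafPushforwardContinuous (Type u) (Scheme.Spec.inducedTopology Scheme.zariskiTopology.{u})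
    Scheme.zariskiTopology.{u}).asEquivalence.counitIso.app (grassmannianAffineSheaf M k)

/-- **On affine schemes the Grassmannian sheaf IS the Grassmannian functor**, naturally in the ring:
`Spec.op ⋙ Gr ≅ (A ↦ G(k, A ⊗_ℤ M; A))` as presheaves on `CommRingCatᵒᵖ`. [cite: GortzWedhorn2020, (8.4) (pp. 213–215)] -/
noncomputable def grassmannianSheafSpecIso :
    Scheme.Spec.op ⋙ (grassmannianSheaf M k).obj ≅ unopUnop CommRingCat.{u} ⋙ grassmannianFunctor.{u, u} M k :=
  (sheafToPresheaf _ _).mapIso (grassmannianSheafRestrictIso M k)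

/-! ## §2 Pointwise comparison on `Spec A` -/

/-- `Gr(Spec A) ≃ G(k, A ⊗_ℤ M; A)`, the component of `grassmannianSheafSpecIso` at `A`. [cite: GortzWedhorn2020, (8.4) (pp. 213–215)] -/
noncomputable def specEquiv (A : CommRingCat.{u}) :
    (grassmannianSheaf M k).obj.obj (op (Spec A)) ≃ Module.Grassmannian A (A ⊗[ℤ] M) k :=
  ((grassmannianSheafSpecIso M k).app (op (op A))).toEquiv

/-- `specEquiv` is the component of `grassmannianSheafSpecIso` (definitional unfolding). [cite: GortzWedhorn2020, (8.4) (pp. 213–215)] -/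
theorem specEquiv_apply (A : CommRingCat.{u}) (x : (grassmannianSheaf M k).obj.obj (op (Spec A))) :
    specEquiv M k A x = (grassmannianSheafSpecIso M k).hom.app (op (op A)) x :=
  rfl

/-- **Naturality of `specEquiv`**: for a ring map `φ : A → B` and `x ∈ Gr(Spec A)`,
`specEquiv B (Gr(Spec φ) x) = Module.Grassmannian.map φ (specEquiv A x)` (base change of the quotient).
[cite: GortzWedhorn2020, (8.4) (pp. 213–215)] -/
theorem specEquiv_naturality {A B : CommRingCat.{u}} (φ : A ⟶ B) (x : (grassmannianSheaf M k).obj.obj (op (Spec A))) :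
    specEquiv M k B ((grassmannianSheaf M k).obj.map (Spec.map φ).op x) =
      Module.Grassmannian.map φ.hom.toIntAlgHom (specEquiv M k A x) := by
  have h := NatTrans.naturality_apply (grassmannianSheafSpecIso M k).hom (X := op (op A)) (Y := op (op B)) φ.op.op x
  exact h

/-! ## §3 Evaluation on affine opens -/

section Eval

variable {M k}

/-- **Evaluation of a section of the Grassmannian sheaf on an affine open** `U ⊆ X`: restrict along
`hU.fromSpec : Spec Γ(X, U) ⟶ X` and read the result in `G(k, Γ(X, U) ⊗_ℤ M; Γ(X, U))` through `specEquiv`.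
[cite: GortzWedhorn2020, (8.4) (pp. 213–215)] -/
noncomputable def evalAffine {X : Scheme.{u}} {U : X.Opens} (hU : IsAffineOpen U)
    (x : (grassmannianSheaf M k).obj.obj (op X)) : Module.Grassmannian Γ(X, U) (Γ(X, U) ⊗[ℤ] M) k :=
  specEquiv M k Γ(X, U) ((grassmannianSheaf M k).obj.map hU.fromSpec.op x)

/-- Definitional unfolding of `evalAffine`. [cite: GortzWedhorn2020, (8.4) (pp. 213–215)] -/
theorem evalAffine_def {X : Scheme.{u}} {U : X.Opens} (hU : IsAffineOpen U) (x : (grassmannianSheaf M k).obj.obj (op X)) :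
    evalAffine hU x = specEquiv M k Γ(X, U) ((grassmannianSheaf M k).obj.map hU.fromSpec.op x) :=
  rfl

/-- **Naturality of `evalAffine`**: for `f : X ⟶ Y`, affine opens `U ⊆ Y`, `V ⊆ X` with `V ≤ f⁻¹U`, and `y ∈ Gr(Y)`,
`evalAffine V (Gr(f) y) = Module.Grassmannian.map (f.appLE U V) (evalAffine U y)` — pull back the quotient along
`Γ(Y, U) → Γ(X, V)`.  (`Spec (f.appLE U V) ≫ fromSpec_U = fromSpec_V ≫ f`, Mathlib `IsAffineOpen.SpecMap_appLE_fromSpec`.)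
[cite: GortzWedhorn2020, (8.4) (pp. 213–215)] -/
theorem evalAffine_map {X Y : Scheme.{u}} (f : X ⟶ Y) {U : Y.Opens} {V : X.Opens} (hU : IsAffineOpen U)
    (hV : IsAffineOpen V) (i : V ≤ f ⁻¹ᵁ U) (y : (grassmannianSheaf M k).obj.obj (op Y)) :
    evalAffine hV ((grassmannianSheaf M k).obj.map f.op y) =
      Module.Grassmannian.map (f.appLE U V i).hom.toIntAlgHom (evalAffine hU y) := by
  rw [evalAffine_def, evalAffine_def, ← specEquiv_naturality, ← Functor.map_comp_apply, ← Functor.map_comp_apply,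
    ← op_comp, ← op_comp, IsAffineOpen.SpecMap_appLE_fromSpec f hU hV i]

/-- Restriction to a smaller affine open `V ≤ U` of `X`: `evalAffine V x = Module.Grassmannian.map (res) (evalAffine U x)`.
[cite: GortzWedhorn2020, (8.4) (pp. 213–215)] -/
theorem evalAffine_of_le {X : Scheme.{u}} {U V : X.Opens} (hU : IsAffineOpen U) (hV : IsAffineOpen V) (i : V ≤ U)
    (x : (grassmannianSheaf M k).obj.obj (op X)) :
    evalAffine hV x = Module.Grassmannian.map (X.presheaf.map (homOfLE i).op).hom.toIntAlgHom (evalAffine hU x) := by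
  have h := evalAffine_map (M := M) (k := k) (𝟙 X) hU hV (by simpa using i) x
  simp only [Scheme.Hom.appLE, Scheme.Hom.id_app, CommRingCat.hom_comp, op_id, Functor.map_id_apply] at h
  rw [h]
  congr 2

variable (M k) in
/-- On an affine scheme `Spec A`, `evalAffine ⊤` is `specEquiv A` followed by base change along `A ≅ Γ(Spec A, ⊤)`
(`Scheme.ΓSpecIso`): `fromSpec_⊤ = (Spec A).isoSpec.inv = Spec (ΓSpecIso A).inv`. [cite: GortzWedhorn2020, (8.4) (pp. 213–215)] -/
theorem evalAffine_top (A : CommRingCat.{u}) (x : (grassmannianSheaf M k).obj.obj (op (Spec A))) :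
    evalAffine (isAffineOpen_top (Spec A)) x =
      Module.Grassmannian.map (Scheme.ΓSpecIso A).inv.hom.toIntAlgHom (specEquiv M k A x) := by
  rw [evalAffine_def, ← specEquiv_naturality, IsAffineOpen.fromSpec_top, Scheme.isoSpec_Spec_inv]

variable (M k) in
/-- On an affine scheme `X`, `evalAffine ⊤ : Gr(X) → G(k, Γ(X, ⊤) ⊗_ℤ M)` is a bijection (`fromSpec_⊤` is the isomorphism
`X.isoSpec.inv`, and `specEquiv` is a bijection). [cite: GortzWedhorn2020, (8.4) (pp. 213–215)] -/
theorem bijective_evalAffine_top (X : Scheme.{u}) [IsAffine X] :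
    Function.Bijective (evalAffine (M := M) (k := k) (isAffineOpen_top X)) := by
  have h1 : Function.Bijective ((grassmannianSheaf M k).obj.map (isAffineOpen_top X).fromSpec.op) := by
    rw [IsAffineOpen.fromSpec_top]
    exact ((grassmannianSheaf M k).obj.mapIso X.isoSpec.symm.op).toEquiv.bijective
  exact (specEquiv M k Γ(X, ⊤)).bijective.comp h1

end Eval

/-! ## §4 The representing scheme and its functor of points (under `IsRepresentable`) -/

section Scheme

variable [(grassmannianSheaf M k).obj.IsRepresentable]

/-- **The Grassmannian scheme of `M` (quotients locally free of rank `k`)**: a chosen scheme representing the Zariski sheaf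
`grassmannianSheaf M k`, available as soon as `(grassmannianSheaf M k).obj.IsRepresentable` (the representability theorem,
(h4) (A4): open cover by the affine chart subfunctors).  [cite: GortzWedhorn2020, (8.4) (pp. 213–215)] [cite: StacksProject, Tag 089R] -/
noncomputable def grassmannianScheme : Scheme.{u} :=
  (grassmannianSheaf M k).obj.reprX

/-- **Functor of points of the Grassmannian scheme**: `(T ⟶ grassmannianScheme M k) ≃ Gr(T)`. [cite: GortzWedhorn2020, (8.4) (pp. 213–215)] -/
noncomputable def pointsEquiv (T : Scheme.{u}) :
    (T ⟶ grassmannianScheme M k) ≃ (grassmannianSheaf M k).obj.obj (op T) :=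
  (grassmannianSheaf M k).obj.representableBy.homEquiv

/-- Naturality of `pointsEquiv`: `pointsEquiv (f ≫ g) = Gr(f) (pointsEquiv g)`. [cite: GortzWedhorn2020, (8.4) (pp. 213–215)] -/
theorem pointsEquiv_comp {T T' : Scheme.{u}} (f : T' ⟶ T) (g : T ⟶ grassmannianScheme M k) :
    pointsEquiv M k T' (f ≫ g) = (grassmannianSheaf M k).obj.map f.op (pointsEquiv M k T g) :=
  (grassmannianSheaf M k).obj.representableBy.homEquiv_comp f g

/-- **The `A`-valued points of the Grassmannian scheme are Mathlib's Grassmannian**: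
`(Spec A ⟶ grassmannianScheme M k) ≃ G(k, A ⊗_ℤ M; A) = Module.Grassmannian A (A ⊗[ℤ] M) k`.
[cite: GortzWedhorn2020, (8.4) (pp. 213–215)] [cite: StacksProject, Tag 089R] -/
noncomputable def specPointsEquiv (A : CommRingCat.{u}) :
    (Spec A ⟶ grassmannianScheme M k) ≃ Module.Grassmannian A (A ⊗[ℤ] M) k :=
  (pointsEquiv M k (Spec A)).trans (specEquiv M k A)

/-- Naturality of `specPointsEquiv` in the ring: `specPointsEquiv B (Spec φ ≫ g) = Module.Grassmannian.map φ (specPointsEquiv A g)`,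
i.e. the bijection identifies the functor of points of `grassmannianScheme M k` on affine schemes with the Grassmannian FUNCTOR
`A ↦ G(k, A ⊗_ℤ M; A)` (Mathlib `Module.Grassmannian.functor`, base ring `ℤ`). [cite: GortzWedhorn2020, (8.4) (pp. 213–215)] -/
theorem specPointsEquiv_naturality {A B : CommRingCat.{u}} (φ : A ⟶ B) (g : Spec A ⟶ grassmannianScheme M k) :
    specPointsEquiv M k B (Spec.map φ ≫ g) = Module.Grassmannian.map φ.hom.toIntAlgHom (specPointsEquiv M k A g) := by
  simp only [specPointsEquiv, Equiv.trans_apply, pointsEquiv_comp, specEquiv_naturality]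

end Scheme

end Literature.AlgebraicGeometry.Motives.Grassmannian
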